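import Literature.Analysis.FluidPDE.LerayEulerCross
import Literature.Analysis.FluidPDE.SerrinEnstrophyGronwall
import HarnessLib

/-!
# The relative-energy inequality between a Leray–Hopf solution and a weak Euler solution with
`∇v + ∇vᵀ ∈ L¹(0,T; L^∞)`, and its Grönwall bound

Analysis/FluidPDE support file (serves the discharge of the barrier fact
`Literature.Barriers.AnomalousDissipation.BrenierDeLellisSzekelyhidi2011_cor1`, Brenier–De Lellis–
Székelyhidi 2011, Thm. 2 / Cor. 1). With the notation of `LerayEulerCross` (`Ψ = φ ⋆ v`,
`U = φ ⋆ u`, `S = G + Gᵀ`, `S_φ = DΨ + DΨᵀ = φ ⋆ S`, `w = u - v`) the cross identity, the energy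
inequality of `u` and the conservation of energy of `v` give, for `e(t) = ∫ |u(t) - v(t)|²`,

  `e(t) ≤ 2‖v₀‖ (‖v₀ - φ⋆v₀‖ + sup ‖v - φ⋆v‖) - 2 ∫₀ᵗ (∫(⟪u,DΨ u⟫ + ν⟪u,ΔΨ⟫) - ∫⟪S v, U⟫)`,

and the slice-wise algebra of Brenier–De Lellis–Székelyhidi, proof of Thm. 2, (10)–(13)
(`leray_euler_slice_ineq`):

  `-(∫(⟪u,DΨ u⟫ + ν⟪u,ΔΨ⟫) - ∫⟪S v, U⟫)`
  `  = -½⟨S_φ w, w⟩ + ⟨φ⋆(S v) - S_φ v, w⟩ + (⟨φ⋆(S v), v⟩ - ½⟨S_φ v, v⟩) - ν⟨u, ΔΨ⟩`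
  `  ≤ ½‖S‖_∞ e + ‖φ⋆(Sv) - S_φ v‖₂ ‖w‖₂ + |⟨φ⋆(Sv), v⟩ - ½⟨S_φ v, v⟩| + ν‖u‖₂‖ΔΨ‖₂`.

All error terms except the Grönwall term `½‖S‖_∞ e` are independent of `u` or carry the factor
`ν`. The integral Grönwall lemma (tree `lintegral_gronwall_le`, Robinson–Rodrigo–Sadowski 2016,
Lemma A.25) then yields `leray_euler_integral_norm_sub_sq_le`:
`e(t) ≤ α exp(∫₀ᵀ ‖S‖_∞)` with `α` the sum of the (doubled) error terms.

## References

* Y. Brenier, C. De Lellis, L. Székelyhidi Jr., *Weak-strong uniqueness for measure-valued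
  solutions*, Comm. Math. Phys. 305 (2011), §3.1, proof of Thm. 2, (9)–(13) and the final
  Grönwall step. [BrenierDeLellisSzekelyhidi2011]
* J. C. Robinson, J. L. Rodrigo, W. Sadowski, *The three-dimensional Navier–Stokes equations*
  (CUP 2016), Lemma A.25 (integral Grönwall). [RobinsonRodrigoSadowski2016]
-/

noncomputable section

open MeasureTheory TopologicalSpace Set Function Filter ContinuousLinearMap InnerProductSpace
open scoped ENNReal NNReal Convolution RealInnerProductSpace Topology Laplacian

namespace Literature.Analysis.FluidPDE

variable {E : Type*} [NormedAddCommGroup E] [InnerProductSpace ℝ E] [FiniteDimensional ℝ E]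
  [MeasurableSpace E] [BorelSpace E] [CompleteSpace E]

/-! ### The slice-wise inequality -/

section Slice

omit [CompleteSpace E] in
/-- Symmetry of the real `L²` pairing (local copy). [folklore] -/
private theorem integral_inner_comm_loc (f g : E → E) : ∫ x, ⟪f x, g x⟫ = ∫ x, ⟪g x, f x⟫ :=
  integral_congr_ae (ae_of_all _ fun _ => real_inner_comm _ _)

omit [CompleteSpace E] in
/-- `∫ ⟪a, a⟫ = ‖a‖²_{L²}` in real form. [folklore] -/
theorem integral_inner_self_eq_sq_toReal_eLpNorm {a : E → E} (ha : MemLp a 2 volume) :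
    ∫ x, ⟪a x, a x⟫ = (eLpNorm a 2 volume).toReal ^ 2 := by
  have h1 : ∫ x, ⟪a x, a x⟫ = ∫ x, ‖a x‖ ^ (2 : ℝ) :=
    integral_congr_ae (ae_of_all _ fun x => by
      dsimp only; rw [real_inner_self_eq_norm_sq, Real.rpow_two])
  have h2 := ha.eLpNorm_eq_integral_rpow_norm two_ne_zero ENNReal.ofNat_ne_top
  rw [ENNReal.toReal_ofNat] at h2
  have hI : 0 ≤ ∫ x, ‖a x‖ ^ (2 : ℝ) := integral_nonneg fun x => by positivity
  rw [h1, h2, ENNReal.toReal_ofReal (by positivity), ← Real.rpow_natCast, ← Real.rpow_mul hI]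
  norm_num
set_option maxHeartbeats 400000 in -- buildfix (bf3-g26): 160k/180k FAIL, 200k PASS at accept time; line-neutral budget line
/-- **The slice-wise relative-energy inequality** (Brenier–De Lellis–Székelyhidi 2011, proof of
Thm. 2, the algebra of (10)–(13) for one time slice). Let `a, b ∈ L²(E;E)` (the Leray and the
Euler slice), `G₀` a weak gradient of `b` with `‖G₀ + G₀ᵀ‖ ≤ C` a.e., `φ` a bump kernel,
`Ψ = φ ⋆ b`, `S₀ = G₀ + G₀ᵀ`, `w = a - b`, `ν ≥ 0`. Then
`-( ∫ (⟪a, DΨ a⟫ + ν ⟪a, ΔΨ⟫) - ∫ ⟪S₀ b, φ ⋆ a⟫ )`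
`  ≤ ½ C ‖w‖₂² + ‖φ⋆(S₀ b) - (DΨ + DΨᵀ) b‖₂ ‖w‖₂ + |∫⟪φ⋆(S₀ b), b⟫ - ½ ∫⟪(DΨ + DΨᵀ) b, b⟫|`
`    + ν ‖a‖₂ ‖ΔΨ‖₂`. [cite: BrenierDeLellisSzekelyhidi2011, §3.1 proof of Thm. 2] -/
theorem leray_euler_slice_ineq {a b : E → E} {G₀ : E → E →L[ℝ] E} (ha : MemLp a 2 volume)
    (hb : MemLp b 2 volume) (hG₀ : HasWeakGradient b G₀) {C : ℝ}
    (hC : ∀ᵐ x ∂(volume : Measure E), ‖G₀ x + adjoint (G₀ x)‖ ≤ C) (φ : ContDiffBump (0 : E))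
    {ν : ℝ} (hν : 0 ≤ ν) :
    -((∫ x, (⟪a x, fderiv ℝ (φ.normed volume ⋆[lsmul ℝ ℝ, volume] b) x (a x)⟫ +
        ν * ⟪a x, (Δ (φ.normed volume ⋆[lsmul ℝ ℝ, volume] b)) x⟫)) -
      ∫ x, ⟪(G₀ x + adjoint (G₀ x)) (b x), (φ.normed volume ⋆[lsmul ℝ ℝ, volume] a) x⟫) ≤
    2⁻¹ * C * (eLpNorm (a - b) 2 volume).toReal ^ 2 +
      (eLpNorm (fun x => (φ.normed volume ⋆[lsmul ℝ ℝ, volume] fun y => (G₀ y + adjoint (G₀ y)) (b y)) x -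
          (fderiv ℝ (φ.normed volume ⋆[lsmul ℝ ℝ, volume] b) x +
            adjoint (fderiv ℝ (φ.normed volume ⋆[lsmul ℝ ℝ, volume] b) x)) (b x)) 2 volume).toReal *
        (eLpNorm (a - b) 2 volume).toReal +
      |(∫ x, ⟪(φ.normed volume ⋆[lsmul ℝ ℝ, volume] fun y => (G₀ y + adjoint (G₀ y)) (b y)) x, b x⟫) -
        2⁻¹ * ∫ x, ⟪(fderiv ℝ (φ.normed volume ⋆[lsmul ℝ ℝ, volume] b) x +
          adjoint (fderiv ℝ (φ.normed volume ⋆[lsmul ℝ ℝ, volume] b) x)) (b x), b x⟫| +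
      ν * (eLpNorm a 2 volume).toReal *
        (eLpNorm (Δ (φ.normed volume ⋆[lsmul ℝ ℝ, volume] b)) 2 volume).toReal := by
  -- ### notation
  set ρ : E → ℝ := φ.normed volume with hρ
  set Ψ : E → E := ρ ⋆[lsmul ℝ ℝ, volume] b with hΨ
  set U : E → E := ρ ⋆[lsmul ℝ ℝ, volume] a with hU
  set S₀ : E → E →L[ℝ] E := fun x => G₀ x + adjoint (G₀ x) with hS₀
  set Sφ : E → E →L[ℝ] E := fun x => fderiv ℝ Ψ x + adjoint (fderiv ℝ Ψ x) with hSφ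
  set Sb : E → E := ρ ⋆[lsmul ℝ ℝ, volume] fun y => S₀ y (b y) with hSb
  set w : E → E := a - b with hw
  set D : E → E := fun x => Sb x - Sφ x (b x) with hD
  -- ### data
  have hC0 : 0 ≤ C := by
    obtain ⟨x, hx⟩ := hC.exists; exact (norm_nonneg _).trans hx
  set Cn : ℝ≥0 := ⟨C, hC0⟩ with hCn
  have hbl : LocallyIntegrable b volume := hb.locallyIntegrable one_le_two
  have hΨs : ContDiff ℝ 2 Ψ := contDiff_normed_convolution_of_locallyIntegrable φ hbl
  have hDΨc : Continuous (fderiv ℝ Ψ) := hΨs.continuous_fderiv two_ne_zero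
  have hSφc : Continuous Sφ :=
    hDΨc.add ((adjoint : (E →L[ℝ] E) ≃ₗᵢ⋆[ℝ] (E →L[ℝ] E)).continuous.comp hDΨc)
  have hSφ_le : ∀ x, ‖Sφ x‖ ≤ C := fun x => hG₀.norm_symGrad_normed_convolution_le φ hC x
  have hS₀m : AEStronglyMeasurable S₀ volume := hG₀.aestronglyMeasurable_symGrad
  obtain ⟨hS₀b2, -⟩ := memLp_clm_apply_of_ae_norm_le hS₀m hb (C := Cn) hC
  have hSb2 : MemLp Sb 2 volume := FunctionSpaces.memLp_normed_convolution φ hS₀b2 one_le_two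
  obtain ⟨hSφb2, -⟩ := memLp_clm_apply_of_norm_le (A := Sφ) hb hSφc.aestronglyMeasurable
    (M := Cn) hSφ_le
  obtain ⟨hSφw2, -⟩ := memLp_clm_apply_of_norm_le (A := Sφ) (ha.sub hb) hSφc.aestronglyMeasurable
    (M := Cn) hSφ_le
  have hw2 : MemLp w 2 volume := ha.sub hb
  have hD2 : MemLp D 2 volume := hSb2.sub hSφb2
  obtain ⟨hΔΨ2, -⟩ := memLp_laplacian_normed_convolution φ hb
  -- ### the six real numbers
  set X₁ : ℝ := ∫ x, ⟪Sφ x (w x), w x⟫ with hX₁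
  set X₂ : ℝ := ∫ x, ⟪Sφ x (b x), w x⟫ with hX₂
  set X₃ : ℝ := ∫ x, ⟪Sφ x (b x), b x⟫ with hX₃
  set Y₁ : ℝ := ∫ x, ⟪Sb x, w x⟫ with hY₁
  set Y₂ : ℝ := ∫ x, ⟪Sb x, b x⟫ with hY₂
  set L : ℝ := ∫ x, ⟪a x, (Δ Ψ) x⟫ with hL
  -- (1) the convective term is `½ ⟨S_φ a, a⟩ = ½ (X₁ + 2 X₂ + X₃)`
  have i_aa : Integrable (fun x => ⟪a x, fderiv ℝ Ψ x (a x)⟫) volume :=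
    (abs_integral_inner_clm_apply_le_of_norm_le ha ha hDΨc.aestronglyMeasurable (by positivity)
      fun x => norm_fderiv_normed_convolution_le φ hb x).1
  have i_L : Integrable (fun x => ⟪a x, (Δ Ψ) x⟫) volume := integrable_inner_of_memLp_two ha hΔΨ2
  have h1 : ∫ x, ⟪a x, fderiv ℝ Ψ x (a x)⟫ = 2⁻¹ * (X₁ + 2 * X₂ + X₃) := by
    have e1 : ∫ x, ⟪a x, fderiv ℝ Ψ x (a x)⟫ = 2⁻¹ * ∫ x, ⟪Sφ x (a x), a x⟫ := by
      rw [← integral_const_mul]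
      refine integral_congr_ae (ae_of_all _ fun x => ?_)
      dsimp only
      rw [real_inner_comm, inner_apply_self_eq_half_inner_symGrad]
    rw [e1]
    congr 1
    have iww : Integrable (fun x => ⟪Sφ x (w x), w x⟫) volume := integrable_inner_of_memLp_two hSφw2 hw2
    have ibw : Integrable (fun x => ⟪Sφ x (b x), w x⟫) volume := integrable_inner_of_memLp_two hSφb2 hw2
    have ibb : Integrable (fun x => ⟪Sφ x (b x), b x⟫) volume := integrable_inner_of_memLp_two hSφb2 hb
    have i12 : Integrable (fun x => ⟪Sφ x (w x), w x⟫ + 2 * ⟪Sφ x (b x), w x⟫) volume :=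
      iww.add (ibw.const_mul 2)
    have hexp : ∫ x, ⟪Sφ x (a x), a x⟫ =
        ∫ x, (⟪Sφ x (w x), w x⟫ + 2 * ⟪Sφ x (b x), w x⟫ + ⟪Sφ x (b x), b x⟫) := by
      refine integral_congr_ae (ae_of_all _ fun x => ?_)
      dsimp only
      have hax : a x = w x + b x := by simp [hw]
      rw [hax, map_add, inner_add_left, inner_add_right, inner_add_right]
      have hsym : ⟪Sφ x (w x), b x⟫ = ⟪Sφ x (b x), w x⟫ := by
        rw [hSφ]; dsimp only
        rw [inner_symGrad_apply_comm, real_inner_comm]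
      rw [hsym]
      ring
    rw [hexp, integral_add i12 ibb, integral_add iww (ibw.const_mul 2), integral_const_mul]
  -- (2) the Euler term is `⟨φ⋆(S₀ b), a⟩ = Y₁ + Y₂`
  have h2 : ∫ x, ⟪S₀ x (b x), U x⟫ = Y₁ + Y₂ := by
    rw [hU, integral_inner_normed_convolution_comm φ hS₀b2 ha]
    have ibw : Integrable (fun x => ⟪Sb x, w x⟫) volume := integrable_inner_of_memLp_two hSb2 hw2
    have ibb : Integrable (fun x => ⟪Sb x, b x⟫) volume := integrable_inner_of_memLp_two hSb2 hb
    rw [hY₁, hY₂, ← integral_add ibw ibb]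
    refine integral_congr_ae (ae_of_all _ fun x => ?_)
    dsimp only
    have hax : a x = w x + b x := by simp [hw]
    rw [hax, inner_add_right]
  -- ### the bounds
  have hN : (eLpNorm w 2 volume).toReal ^ 2 = ∫ x, ⟪w x, w x⟫ :=
    (integral_inner_self_eq_sq_toReal_eLpNorm hw2).symm
  have b1 : -X₁ ≤ C * (eLpNorm w 2 volume).toReal ^ 2 := by
    rw [hN, ← integral_const_mul, hX₁, ← integral_neg]
    have iww : Integrable (fun x => ⟪Sφ x (w x), w x⟫) volume := integrable_inner_of_memLp_two hSφw2 hw2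
    refine integral_mono iww.neg ((integrable_inner_of_memLp_two hw2 hw2).const_mul C)
      fun x => ?_
    dsimp only
    rw [real_inner_self_eq_norm_sq]
    have h := abs_real_inner_le_norm (Sφ x (w x)) (w x)
    have h' : ‖Sφ x (w x)‖ ≤ C * ‖w x‖ :=
      (le_opNorm _ _).trans (mul_le_mul_of_nonneg_right (hSφ_le x) (norm_nonneg _))
    have : |⟪Sφ x (w x), w x⟫| ≤ C * ‖w x‖ ^ 2 := by nlinarith [norm_nonneg (w x)]
    linarith [neg_abs_le ⟪Sφ x (w x), w x⟫]
  have b2 : Y₁ - X₂ ≤ (eLpNorm D 2 volume).toReal * (eLpNorm w 2 volume).toReal := by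
    have ibw : Integrable (fun x => ⟪Sb x, w x⟫) volume := integrable_inner_of_memLp_two hSb2 hw2
    have ibw' : Integrable (fun x => ⟪Sφ x (b x), w x⟫) volume := integrable_inner_of_memLp_two hSφb2 hw2
    have e : Y₁ - X₂ = ∫ x, ⟪D x, w x⟫ := by
      rw [hY₁, hX₂, ← integral_sub ibw ibw']
      refine integral_congr_ae (ae_of_all _ fun x => ?_)
      rw [hD]; dsimp only; rw [inner_sub_left]
    rw [e]
    exact (le_abs_self _).trans (abs_integral_inner_le_toReal_eLpNorm_mul hD2 hw2)
  have b4 : -(ν * L) ≤ ν * (eLpNorm a 2 volume).toReal * (eLpNorm (Δ Ψ) 2 volume).toReal := by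
    have h := abs_integral_inner_le_toReal_eLpNorm_mul ha hΔΨ2
    rw [← hL] at h
    have : -L ≤ (eLpNorm a 2 volume).toReal * (eLpNorm (Δ Ψ) 2 volume).toReal :=
      (neg_le_abs L).trans h
    nlinarith
  -- ### assemble
  rw [integral_add i_aa (i_L.const_mul ν), integral_const_mul, h1, h2]
  have key : -(2⁻¹ * (X₁ + 2 * X₂ + X₃) + ν * L - (Y₁ + Y₂)) =
      2⁻¹ * (-X₁) + (Y₁ - X₂) + (Y₂ - 2⁻¹ * X₃) + -(ν * L) := by ring
  rw [key]
  have b3 : Y₂ - 2⁻¹ * X₃ ≤ |Y₂ - 2⁻¹ * X₃| := le_abs_self _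
  nlinarith [b1, b2, b3, b4, hC0]

end Slice

/-! ### The Grönwall bound -/

section Gronwall

variable {T ν : ℝ} {v₀ : E → E} {u v : ℝ → E → E} {G : ℝ → E → E →L[ℝ] E}

omit [CompleteSpace E] in
/-- `∫ ‖a - b‖² = ∫⟪a,a⟫ + ∫⟪b,b⟫ - 2∫⟪a,b⟫` for `a, b ∈ L²`. [folklore] -/
theorem integral_norm_sub_sq_eq_inner {a b : E → E} (ha : MemLp a 2 volume) (hb : MemLp b 2 volume) :
    ∫ x, ‖a x - b x‖ ^ 2 = (∫ x, ⟪a x, a x⟫) + (∫ x, ⟪b x, b x⟫) - 2 * ∫ x, ⟪a x, b x⟫ := by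
  have iaa := integrable_inner_of_memLp_two ha ha
  have ibb := integrable_inner_of_memLp_two hb hb
  have iab := integrable_inner_of_memLp_two ha hb
  have i12 : Integrable (fun x => ⟪a x, a x⟫ + ⟪b x, b x⟫) volume := iaa.add ibb
  have hexp : ∫ x, ‖a x - b x‖ ^ 2 = ∫ x, (⟪a x, a x⟫ + ⟪b x, b x⟫ - 2 * ⟪a x, b x⟫) := by
    refine integral_congr_ae (ae_of_all _ fun x => ?_)
    dsimp only
    rw [← real_inner_self_eq_norm_sq, inner_sub_left, inner_sub_right, inner_sub_right,
      real_inner_comm (b x) (a x)]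
    ring
  rw [hexp, integral_sub i12 (iab.const_mul 2), integral_add iaa ibb, integral_const_mul]

omit [CompleteSpace E] in
/-- `t ↦ ∫ ‖u t - v t‖²` is a.e.-strongly measurable on `(0,T)` for jointly a.e.-measurable
fields. [folklore] -/
theorem aestronglyMeasurable_integral_norm_sub_sq
    (hum : AEStronglyMeasurable (uncurry u) (volume.restrict (Ioo 0 T ×ˢ univ)))
    (hvm : AEStronglyMeasurable (uncurry v) (volume.restrict (Ioo 0 T ×ˢ univ))) :
    AEStronglyMeasurable (fun t => ∫ x, ‖u t x - v t x‖ ^ 2) (volume.restrict (Ioo 0 T)) := by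
  have hu' : AEStronglyMeasurable (uncurry u)
      (((volume : Measure ℝ).restrict (Ioo 0 T)).prod (volume : Measure E)) := by
    rw [restrict_prod_volume_eq]; exact hum
  have hv' : AEStronglyMeasurable (uncurry v)
      (((volume : Measure ℝ).restrict (Ioo 0 T)).prod (volume : Measure E)) := by
    rw [restrict_prod_volume_eq]; exact hvm
  have h : AEStronglyMeasurable (fun p : ℝ × E => ‖uncurry u p - uncurry v p‖ ^ 2)
      (((volume : Measure ℝ).restrict (Ioo 0 T)).prod (volume : Measure E)) :=
    ((hu'.sub hv').norm.pow 2)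
  exact h.integral_prod_right'

-- a long bookkeeping proof (four steps, many `L²` estimates); the default budget does not suffice
set_option maxHeartbeats 1600000 in
/-- **The Grönwall bound for the relative energy** (Brenier–De Lellis–Székelyhidi 2011, proof of
Thm. 2, final step, for a Leray solution in place of the measure-valued solution). Let `u` be an
unforced Leray–Hopf solution (viscosity `ν ≥ 0`, datum `v₀ ∈ L²`), `v` a weak Euler solution with
datum `v₀`, continuous into `L²`, with a jointly measurable weak-gradient witness `G`,
`S = G + Gᵀ`, `∫₀ᵀ‖S‖_∞ < ∞`; `‖v(s)‖_{L²} ≤ R` on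
`[0,T]`, `φ` a spatial bump kernel and `η₁ ≥ sup_{[0,T]} ‖v - φ ⋆ v‖_{L²}`. Then for every
`t ∈ (0,T]`, with `N₀ = ‖v₀‖_{L²}`,
`∫ |u(t) - v(t)|² ≤ ( 2N₀(‖v₀ - φ⋆v₀‖ + η₁) + 2 ∫₀ᵀ err_φ + 2T ν N₀ ‖Δφ‖₁ R ) · exp(∫₀ᵀ ‖S‖_∞)`,
where the `u`-independent error is
`err_φ(s) = 2(N₀ + R) ‖φ⋆(S v) - (φ⋆S) v‖_{L²} + |∫⟪φ⋆(S v), v⟫ - ½∫⟪(φ⋆S) v, v⟫|`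
(as a lower integral in time). [cite: BrenierDeLellisSzekelyhidi2011, §3.1 proof of Thm. 2] -/
theorem leray_euler_integral_norm_sub_sq_le (hT : 0 < T) (hν : 0 ≤ ν) (hu : IsLerayHopfOn T ν 0 v₀ u)
    (hv : IsWeakNSSolutionOn T 0 0 v₀ v) (hc : ContinuousInLpOn (Icc 0 T) 2 v)
    (hv₀ : MemLp v₀ 2 volume) (hv₀div : IsWeaklyDivFree v₀)
    (hG : ∀ᵐ t ∂(volume.restrict (Ioo 0 T)), HasWeakGradient (v t) (G t))
    (hGm : StronglyMeasurable (uncurry G))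
    (hS : ∫⁻ t in Ioo 0 T, eLpNorm (fun x => G t x + adjoint (G t x)) ∞ volume < ∞)
    {R : ℝ≥0} (hR : ∀ s ∈ Icc 0 T, eLpNorm (v s) 2 volume ≤ R) (φ : ContDiffBump (0 : E))
    {η₁ : ℝ} (hη₁ : ∀ s ∈ Icc 0 T,
      (eLpNorm (v s - φ.normed volume ⋆[lsmul ℝ ℝ, volume] v s) 2 volume).toReal ≤ η₁)
    {t : ℝ} (ht : t ∈ Ioc 0 T) :
    ∫ x, ‖u t x - v t x‖ ^ 2 ≤
      (2 * (eLpNorm v₀ 2 volume).toReal *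
          ((eLpNorm (v₀ - φ.normed volume ⋆[lsmul ℝ ℝ, volume] v₀) 2 volume).toReal + η₁) +
        2 * (∫⁻ s in Ioo 0 T, ENNReal.ofReal
          (2 * ((eLpNorm v₀ 2 volume).toReal + R) *
            (eLpNorm (fun x => (φ.normed volume ⋆[lsmul ℝ ℝ, volume]
                fun y => (G s y + adjoint (G s y)) (v s y)) x -
              ((φ.normed volume ⋆[lsmul ℝ ℝ, volume] fun y => G s y + adjoint (G s y)) x)
                (v s x)) 2 volume).toReal +
          |(∫ x, ⟪(φ.normed volume ⋆[lsmul ℝ ℝ, volume]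
              fun y => (G s y + adjoint (G s y)) (v s y)) x, v s x⟫) -
            2⁻¹ * ∫ x, ⟪((φ.normed volume ⋆[lsmul ℝ ℝ, volume]
              fun y => G s y + adjoint (G s y)) x) (v s x), v s x⟫|)).toReal +
        2 * T * (ν * (eLpNorm v₀ 2 volume).toReal *
          ((∫⁻ y, ‖(Δ (φ.normed volume)) y‖ₑ).toReal * R))) *
      Real.exp (∫⁻ s in Ioo 0 T, eLpNorm (fun x => G s x + adjoint (G s x)) ∞ volume).toReal := by
  -- ### notation
  set ρ : E → ℝ := φ.normed volume with hρ
  set S : ℝ → E → E →L[ℝ] E := fun t x => G t x + adjoint (G t x) with hSdef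
  set N₀ : ℝ := (eLpNorm v₀ 2 volume).toReal with hN₀
  set K₂ : ℝ := (∫⁻ y, ‖(Δ ρ) y‖ₑ).toReal with hK₂
  set η₀ : ℝ := (eLpNorm (v₀ - ρ ⋆[lsmul ℝ ℝ, volume] v₀) 2 volume).toReal with hη₀
  set c : ℝ → ℝ := fun s => (eLpNorm (S s) ∞ volume).toReal with hcdef
  set e : ℝ → ℝ := fun s => ∫ x, ‖u s x - v s x‖ ^ 2 with hedef
  set Sv : ℝ → E → E := fun s => ρ ⋆[lsmul ℝ ℝ, volume] fun y => S s y (v s y) with hSv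
  set SS : ℝ → E → E →L[ℝ] E := fun s x => (ρ ⋆[lsmul ℝ ℝ, volume] S s) x with hSS
  set err : ℝ → ℝ := fun s => 2 * (N₀ + R) * (eLpNorm (fun x => Sv s x - SS s x (v s x)) 2 volume).toReal +
    |(∫ x, ⟪Sv s x, v s x⟫) - 2⁻¹ * ∫ x, ⟪SS s x (v s x), v s x⟫| with herr
  set Λ : ℝ := (∫⁻ s in Ioo 0 T, eLpNorm (S s) ∞ volume).toReal with hΛ
  set α₀ : ℝ := 2 * N₀ * (η₀ + η₁) + 2 * (∫⁻ s in Ioo 0 T, ENNReal.ofReal (err s)).toReal +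
    2 * T * (ν * N₀ * (K₂ * R)) with hα₀
  show e t ≤ α₀ * Real.exp Λ
  have hN₀0 : 0 ≤ N₀ := ENNReal.toReal_nonneg
  have hK₂0 : 0 ≤ K₂ := ENNReal.toReal_nonneg
  have hR0 : 0 ≤ (R : ℝ) := R.2
  have hSm : StronglyMeasurable (uncurry S) := stronglyMeasurable_uncurry_symGrad hGm
  have hcm : Measurable fun s => eLpNorm (S s) ∞ volume := FunctionSpaces.measurable_eLpNorm_slice hSm ∞
  have hcm' : Measurable c := hcm.ennreal_toReal
  -- `L²` bounds
  have hNu : ∀ s ∈ Icc 0 T, (eLpNorm (u s) 2 volume).toReal ≤ N₀ := fun s hs =>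
    ENNReal.toReal_mono hv₀.eLpNorm_ne_top (hu.eLpNorm_le_eLpNorm_datum hν hv₀ hs)
  have hNv : ∀ s ∈ Icc 0 T, (eLpNorm (v s) 2 volume).toReal ≤ R := fun s hs => by
    have := ENNReal.toReal_mono ENNReal.coe_ne_top (hR s hs)
    rwa [ENNReal.coe_toReal] at this
  have hIoc : ∀ s ∈ Ioc 0 t, s ∈ Icc 0 T := fun s hs => ⟨hs.1.le, hs.2.trans ht.2⟩
  have htT : Ioo (0 : ℝ) t ⊆ Ioo 0 T := Ioo_subset_Ioo le_rfl ht.2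
  -- `η₁ ≥ 0` (from the hypothesis at `s = 0`)
  have hη₁0 : 0 ≤ η₁ := ENNReal.toReal_nonneg.trans (hη₁ 0 (left_mem_Icc.2 hT.le))
  -- ### Step 1: the energy expansion, `e t ≤ 2N₀(η₀+η₁) - 2 ∫ (F - Gs)`
  set Ψ : ℝ → E → E := fun s => ρ ⋆[lsmul ℝ ℝ, volume] v s with hΨ
  set Uu : ℝ → E → E := fun s => ρ ⋆[lsmul ℝ ℝ, volume] u s with hUu
  set FG : ℝ → ℝ := fun s => (∫ x, (⟪u s x, fderiv ℝ (Ψ s) x (u s x)⟫ +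
    ν * ⟪u s x, (Δ (Ψ s)) x⟫)) - ∫ x, ⟪S s x (v s x), Uu s x⟫ with hFG
  have hstep1 : ∀ t ∈ Ioc 0 T, e t ≤ 2 * N₀ * (η₀ + η₁) + 2 * -(∫ s in Ioo 0 t, FG s) := by
    intro t ht
    have hIoc : ∀ s ∈ Ioc 0 t, s ∈ Icc 0 T := fun s hs => ⟨hs.1.le, hs.2.trans ht.2⟩
    have hcross := leray_euler_cross_identity hT hν hu hv hc hv₀ hv₀div hG hGm hS φ ht
    have hmemut : MemLp (u t) 2 volume := hu.memLp t (hIoc t ⟨ht.1, le_rfl⟩)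
    have hmemvt : MemLp (v t) 2 volume := hc.1 t (hIoc t ⟨ht.1, le_rfl⟩)
    have hmemΨt : MemLp (Ψ t) 2 volume := FunctionSpaces.memLp_normed_convolution φ hmemvt one_le_two
    have hexp := integral_norm_sub_sq_eq_inner hmemut hmemvt
    have huu : ∫ x, ⟪u t x, u t x⟫ ≤ N₀ ^ 2 := by
      rw [integral_inner_self_eq_sq_toReal_eLpNorm hmemut]
      exact pow_le_pow_left₀ ENNReal.toReal_nonneg (hNu t (hIoc t ⟨ht.1, le_rfl⟩)) 2
    have hvv : ∫ x, ⟪v t x, v t x⟫ = N₀ ^ 2 := by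
      rw [euler_integral_inner_self_eq hT hv hc hv₀ hv₀div hG hGm hS ht,
        integral_inner_self_eq_sq_toReal_eLpNorm hv₀]
    -- `⟨u t, v t⟩ = ⟨u t, Ψ t⟩ + ⟨u t, v t - Ψ t⟩`
    have huv : ∫ x, ⟪u t x, v t x⟫ = (∫ x, ⟪u t x, Ψ t x⟫) + ∫ x, ⟪u t x, (v t - Ψ t) x⟫ := by
      rw [← integral_add (integrable_inner_of_memLp_two hmemut hmemΨt)
        (integrable_inner_of_memLp_two hmemut (hmemvt.sub hmemΨt))]
      refine integral_congr_ae (ae_of_all _ fun x => ?_)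
      dsimp only
      rw [Pi.sub_apply, ← inner_add_right, add_sub_cancel]
    -- the two small terms
    have hsmall1 : |(∫ x, ⟪v₀ x, v₀ x⟫) - ∫ x, ⟪v₀ x, (ρ ⋆[lsmul ℝ ℝ, volume] v₀) x⟫| ≤ N₀ * η₀ := by
      have hw2 : MemLp (ρ ⋆[lsmul ℝ ℝ, volume] v₀) 2 volume :=
        FunctionSpaces.memLp_normed_convolution φ hv₀ one_le_two
      rw [← integral_sub (integrable_inner_of_memLp_two hv₀ hv₀) (integrable_inner_of_memLp_two hv₀ hw2)]
      have : (fun x => ⟪v₀ x, v₀ x⟫ - ⟪v₀ x, (ρ ⋆[lsmul ℝ ℝ, volume] v₀) x⟫) =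
          fun x => ⟪v₀ x, (v₀ - ρ ⋆[lsmul ℝ ℝ, volume] v₀) x⟫ := by
        ext x; rw [Pi.sub_apply, inner_sub_right]
      rw [this]
      exact abs_integral_inner_le_toReal_eLpNorm_mul hv₀ (hv₀.sub hw2)
    have hsmall2 : |∫ x, ⟪u t x, (v t - Ψ t) x⟫| ≤ N₀ * η₁ := by
      refine (abs_integral_inner_le_toReal_eLpNorm_mul hmemut (hmemvt.sub hmemΨt)).trans ?_
      exact mul_le_mul (hNu t (hIoc t ⟨ht.1, le_rfl⟩)) (hη₁ t (hIoc t ⟨ht.1, le_rfl⟩))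
        ENNReal.toReal_nonneg hN₀0
    have hcross' : ∫ x, ⟪u t x, Ψ t x⟫ =
        (∫ x, ⟪v₀ x, (ρ ⋆[lsmul ℝ ℝ, volume] v₀) x⟫) + ∫ s in Ioo 0 t, FG s := hcross
    rw [hedef]
    dsimp only
    rw [hexp, hvv, huv, hcross']
    rw [integral_inner_self_eq_sq_toReal_eLpNorm hv₀] at hsmall1
    have h1 : N₀ ^ 2 - ∫ x, ⟪v₀ x, (ρ ⋆[lsmul ℝ ℝ, volume] v₀) x⟫ ≤ N₀ * η₀ :=
      (le_abs_self _).trans hsmall1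
    have h2 : -(∫ x, ⟪u t x, (v t - Ψ t) x⟫) ≤ N₀ * η₁ := (neg_le_abs _).trans hsmall2
    linarith [huu, h1, h2]
  -- ### Step 2: the slice inequality for a.e. `s ∈ (0,T)`
  set Kc : ℝ := ν * N₀ * (K₂ * R) with hKc
  have hKc0 : 0 ≤ Kc := by positivity
  have hgood := euler_ae_good_time hv hG hGm hS
  have hslice : ∀ᵐ s ∂(volume.restrict (Ioo 0 T)),
      -FG s ≤ 2⁻¹ * (c s * e s) + err s + Kc ∧ err s ≤ (4 * (N₀ + R) * R + 2 * R * R) * c s := by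
    filter_upwards [hgood] with s hsg
    obtain ⟨hsI, -, hGs, hcs, hae⟩ := hsg
    have hsIcc : s ∈ Icc 0 T := Ioo_subset_Icc_self hsI
    have hus : MemLp (u s) 2 volume := hu.memLp s hsIcc
    have hvs : MemLp (v s) 2 volume := hc.1 s hsIcc
    have hc0 : 0 ≤ c s := ENNReal.toReal_nonneg
    -- the slice inequality, with its atoms named
    have key := leray_euler_slice_ineq hus hvs hGs hae φ hν
    have hSSx : ∀ x, fderiv ℝ (φ.normed volume ⋆[lsmul ℝ ℝ, volume] v s) x +
        adjoint (fderiv ℝ (φ.normed volume ⋆[lsmul ℝ ℝ, volume] v s) x) = SS s x := fun x =>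
      hGs.symGrad_normed_convolution φ x
    simp only [hSSx] at key
    have e1 : φ.normed volume ⋆[lsmul ℝ ℝ, volume] v s = Ψ s := rfl
    have e2 : φ.normed volume ⋆[lsmul ℝ ℝ, volume] u s = Uu s := rfl
    have e3 : (φ.normed volume ⋆[lsmul ℝ ℝ, volume] fun y => (G s y + adjoint (G s y)) (v s y)) =
        Sv s := rfl
    have e4 : ∀ x, G s x + adjoint (G s x) = S s x := fun x => rfl
    have e5 : (eLpNorm (fun x => G s x + adjoint (G s x)) ∞ volume).toReal = c s := rfl
    simp only [e1, e2, e3, e5] at key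
    simp only [e4] at key
    -- sizes
    set W : ℝ := (eLpNorm (u s - v s) 2 volume).toReal with hW
    set Rr : ℝ := (eLpNorm (fun x => Sv s x - SS s x (v s x)) 2 volume).toReal with hRr
    set Cφ : ℝ := |(∫ x, ⟪Sv s x, v s x⟫) - 2⁻¹ * ∫ x, ⟪SS s x (v s x), v s x⟫| with hCφ
    set Nu : ℝ := (eLpNorm (u s) 2 volume).toReal with hNu'
    set LΔ : ℝ := (eLpNorm (Δ (Ψ s)) 2 volume).toReal with hLΔ
    have hW0 : 0 ≤ W := ENNReal.toReal_nonneg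
    have hRr0 : 0 ≤ Rr := ENNReal.toReal_nonneg
    have hNu0 : 0 ≤ Nu := ENNReal.toReal_nonneg
    have hLΔ0 : 0 ≤ LΔ := ENNReal.toReal_nonneg
    have hes : e s = W ^ 2 := by
      rw [hW, ← integral_inner_self_eq_sq_toReal_eLpNorm (hus.sub hvs), hedef]
      exact integral_congr_ae (ae_of_all _ fun x => by
        dsimp only; rw [Pi.sub_apply, real_inner_self_eq_norm_sq])
    have hNw : W ≤ N₀ + R := by
      have h := ENNReal.toReal_mono (ENNReal.add_ne_top.2 ⟨hus.eLpNorm_ne_top, hvs.eLpNorm_ne_top⟩)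
        (eLpNorm_sub_le hus.1 hvs.1 one_le_two)
      rw [ENNReal.toReal_add hus.eLpNorm_ne_top hvs.eLpNorm_ne_top] at h
      exact h.trans (add_le_add (hNu s hsIcc) (hNv s hsIcc))
    have hΔ : LΔ ≤ K₂ * R := by
      obtain ⟨-, h2⟩ := memLp_laplacian_normed_convolution φ hvs
      have hK₂fin : (∫⁻ y, ‖(Δ ρ) y‖ₑ) ≠ ⊤ := (integrable_laplacian_normed φ).2.ne
      have := ENNReal.toReal_mono (ENNReal.mul_ne_top hK₂fin hvs.eLpNorm_ne_top) h2
      rw [ENNReal.toReal_mul] at this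
      exact this.trans (mul_le_mul_of_nonneg_left (hNv s hsIcc) hK₂0)
    -- sizes of the error pieces (through `c s`)
    set Cn : ℝ≥0 := ⟨c s, hc0⟩ with hCn
    have hSSle : ∀ x, ‖SS s x‖ ≤ c s := fun x => by
      rw [← hSSx]; exact hGs.norm_symGrad_normed_convolution_le φ hae x
    obtain ⟨hSvt2, hSvt_le⟩ := memLp_clm_apply_of_ae_norm_le
      ((hSm.of_uncurry_left (x := s)).aestronglyMeasurable) hvs (C := Cn) hae
    have hSv2 : MemLp (Sv s) 2 volume := FunctionSpaces.memLp_normed_convolution φ hSvt2 one_le_two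
    have hSv_le : (eLpNorm (Sv s) 2 volume).toReal ≤ c s * R := by
      have h1 := (FunctionSpaces.eLpNorm_normed_convolution_le φ hSvt2.1 one_le_two).trans hSvt_le
      have := ENNReal.toReal_mono (ENNReal.mul_ne_top ENNReal.coe_ne_top hvs.eLpNorm_ne_top) h1
      rw [ENNReal.toReal_mul, ENNReal.coe_toReal] at this
      exact this.trans (mul_le_mul_of_nonneg_left (hNv s hsIcc) hc0)
    obtain ⟨hSSv2, hSSv_le'⟩ := memLp_clm_apply_of_norm_le (A := SS s) hvs
      ((stronglyMeasurable_uncurry_convolution_lsmul φ.continuous_normed hSm).of_uncurry_left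
        (x := s)).aestronglyMeasurable (M := Cn) hSSle
    have hSSv_le : (eLpNorm (fun x => SS s x (v s x)) 2 volume).toReal ≤ c s * R := by
      have := ENNReal.toReal_mono (ENNReal.mul_ne_top ENNReal.coe_ne_top hvs.eLpNorm_ne_top) hSSv_le'
      rw [ENNReal.toReal_mul, ENNReal.coe_toReal] at this
      exact this.trans (mul_le_mul_of_nonneg_left (hNv s hsIcc) hc0)
    have hr_le : Rr ≤ 2 * (c s * R) := by
      have h := ENNReal.toReal_mono (ENNReal.add_ne_top.2 ⟨hSv2.eLpNorm_ne_top, hSSv2.eLpNorm_ne_top⟩)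
        (eLpNorm_sub_le hSv2.1 hSSv2.1 one_le_two)
      rw [ENNReal.toReal_add hSv2.eLpNorm_ne_top hSSv2.eLpNorm_ne_top] at h
      have h' : eLpNorm (fun x => Sv s x - SS s x (v s x)) 2 volume =
          eLpNorm (Sv s - fun x => SS s x (v s x)) 2 volume := rfl
      rw [hRr, h']
      linarith
    have hcφ_le : Cφ ≤ 2 * R * R * c s := by
      have h3 : |(∫ x, ⟪Sv s x, v s x⟫)| ≤ c s * R * R :=
        (abs_integral_inner_le_toReal_eLpNorm_mul hSv2 hvs).trans
          (mul_le_mul hSv_le (hNv s hsIcc) ENNReal.toReal_nonneg (by positivity))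
      have h4 : |∫ x, ⟪SS s x (v s x), v s x⟫| ≤ c s * R * R :=
        (abs_integral_inner_le_toReal_eLpNorm_mul hSSv2 hvs).trans
          (mul_le_mul hSSv_le (hNv s hsIcc) ENNReal.toReal_nonneg (by positivity))
      have h5 : |2⁻¹ * ∫ x, ⟪SS s x (v s x), v s x⟫| ≤ 2⁻¹ * (c s * R * R) := by
        rw [abs_mul, abs_of_pos (by norm_num : (0:ℝ) < 2⁻¹)]
        exact mul_le_mul_of_nonneg_left h4 (by norm_num)
      calc Cφ ≤ |∫ x, ⟪Sv s x, v s x⟫| + |2⁻¹ * ∫ x, ⟪SS s x (v s x), v s x⟫| := abs_sub _ _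
        _ ≤ c s * R * R + 2⁻¹ * (c s * R * R) := add_le_add h3 h5
        _ ≤ 2 * R * R * c s := by nlinarith [mul_nonneg (mul_nonneg hc0 hR0) hR0]
    refine ⟨?_, ?_⟩
    · have hterm2 : Rr * W ≤ 2 * (N₀ + R) * Rr := by
        have h1 : Rr * W ≤ Rr * (N₀ + R) := mul_le_mul_of_nonneg_left hNw hRr0
        have h2 : 0 ≤ (N₀ + R) * Rr := by positivity
        linarith
      have hterm4 : ν * Nu * LΔ ≤ Kc := by
        rw [hKc]
        exact mul_le_mul (mul_le_mul_of_nonneg_left (hNu s hsIcc) hν) hΔ hLΔ0 (by positivity)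
      have herr_s : err s = 2 * (N₀ + R) * Rr + Cφ := by rw [herr]
      have hFG_s : FG s = (∫ x, (⟪u s x, fderiv ℝ (Ψ s) x (u s x)⟫ + ν * ⟪u s x, (Δ (Ψ s)) x⟫)) -
          ∫ x, ⟪S s x (v s x), Uu s x⟫ := by rw [hFG]
      rw [hFG_s, herr_s, hes]
      have hcW : 2⁻¹ * c s * W ^ 2 = 2⁻¹ * (c s * W ^ 2) := by ring
      linarith [key, hterm2, hterm4, hcW]
    · have herr_s : err s = 2 * (N₀ + R) * Rr + Cφ := by rw [herr]
      rw [herr_s]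
      calc 2 * (N₀ + R) * Rr + Cφ ≤ 2 * (N₀ + R) * (2 * (c s * R)) + 2 * R * R * c s :=
            add_le_add (mul_le_mul_of_nonneg_left hr_le (by positivity)) hcφ_le
        _ = (4 * (N₀ + R) * R + 2 * R * R) * c s := by ring
  -- ### Step 3: lower-integral form of Steps 1–2
  -- finiteness of the kernel and of the error integral
  have hcofReal : ∀ s, ENNReal.ofReal (c s) ≤ eLpNorm (S s) ∞ volume := fun s => ENNReal.ofReal_toReal_le
  have hΛfin : ∫⁻ s in Ioo 0 T, eLpNorm (S s) ∞ volume ≠ ⊤ := hS.ne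
  have haint : ∫⁻ s in Ioo 0 T, ENNReal.ofReal (c s) ≤ ∫⁻ s in Ioo 0 T, eLpNorm (S s) ∞ volume :=
    lintegral_mono fun s => hcofReal s
  set Ce : ℝ := 4 * (N₀ + R) * R + 2 * R * R with hCe
  have hCe0 : 0 ≤ Ce := by positivity
  have herr_fin : ∫⁻ s in Ioo 0 T, ENNReal.ofReal (err s) < ⊤ := by
    calc ∫⁻ s in Ioo 0 T, ENNReal.ofReal (err s) ≤ ∫⁻ s in Ioo 0 T, ENNReal.ofReal Ce * ENNReal.ofReal (c s) := by
          refine lintegral_mono_ae ?_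
          filter_upwards [hslice] with s hs
          rw [← ENNReal.ofReal_mul hCe0]
          exact ENNReal.ofReal_le_ofReal hs.2
      _ = ENNReal.ofReal Ce * ∫⁻ s in Ioo 0 T, ENNReal.ofReal (c s) :=
          lintegral_const_mul _ hcm'.ennreal_ofReal
      _ < ⊤ := ENNReal.mul_lt_top ENNReal.ofReal_lt_top (haint.trans_lt hS)
  -- measurability of `e` and the bound `e ≤ (N₀ + R)²`
  have hem : AEStronglyMeasurable e (volume.restrict (Ioo 0 T)) :=
    aestronglyMeasurable_integral_norm_sub_sq hu.weak.1 hv.1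
  have he0 : ∀ s, 0 ≤ e s := fun s => integral_nonneg fun x => by positivity
  have heM : ∀ s ∈ Icc 0 T, e s ≤ (N₀ + R) ^ 2 := by
    intro s hs
    have hus : MemLp (u s) 2 volume := hu.memLp s hs
    have hvs : MemLp (v s) 2 volume := hc.1 s hs
    have hes : e s = (eLpNorm (u s - v s) 2 volume).toReal ^ 2 := by
      rw [← integral_inner_self_eq_sq_toReal_eLpNorm (hus.sub hvs), hedef]
      exact integral_congr_ae (ae_of_all _ fun x => by
        dsimp only; rw [Pi.sub_apply, real_inner_self_eq_norm_sq])
    have hNw : (eLpNorm (u s - v s) 2 volume).toReal ≤ N₀ + R := by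
      have h := ENNReal.toReal_mono (ENNReal.add_ne_top.2 ⟨hus.eLpNorm_ne_top, hvs.eLpNorm_ne_top⟩)
        (eLpNorm_sub_le hus.1 hvs.1 one_le_two)
      rw [ENNReal.toReal_add hus.eLpNorm_ne_top hvs.eLpNorm_ne_top] at h
      exact h.trans (add_le_add (hNu s hs) (hNv s hs))
    rw [hes]
    exact pow_le_pow_left₀ ENNReal.toReal_nonneg hNw 2
  -- the real integral against the lower integral
  have hint_le : ∀ {τ : ℝ} (f : ℝ → ℝ), ∫⁻ s in Ioo 0 τ, ENNReal.ofReal (f s) ≠ ⊤ →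
      ∫ s in Ioo 0 τ, f s ≤ (∫⁻ s in Ioo 0 τ, ENNReal.ofReal (f s)).toReal := by
    intro τ f hfin
    by_cases hf : Integrable f (volume.restrict (Ioo 0 τ))
    · calc ∫ s in Ioo 0 τ, f s ≤ ∫ s in Ioo 0 τ, (ENNReal.ofReal (f s)).toReal := by
            refine integral_mono hf ?_ fun s => ?_
            · have : (fun s => (ENNReal.ofReal (f s)).toReal) = fun s => max (f s) 0 := by
                ext s; exact ENNReal.toReal_ofReal' 
              rw [this]; exact hf.pos_part
            · rw [ENNReal.toReal_ofReal']; exact le_max_left _ _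
        _ = (∫⁻ s in Ioo 0 τ, ENNReal.ofReal (f s)).toReal :=
            integral_toReal hf.1.aemeasurable.ennreal_ofReal (ae_of_all _ fun s => ENNReal.ofReal_lt_top)
    · rw [integral_undef hf]; exact ENNReal.toReal_nonneg
  -- the ENNReal data of the Grönwall lemma
  set aG : ℝ → ℝ≥0∞ := fun s => ENNReal.ofReal (c s) with haG
  set φG : ℝ → ℝ≥0∞ := fun s => if 0 < s then ENNReal.ofReal (e s) else 0 with hφG
  set Ierr : ℝ≥0∞ := ∫⁻ s in Ioo 0 T, ENNReal.ofReal (err s) with hIerr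
  set B : ℝ≥0∞ := ENNReal.ofReal (2 * N₀ * (η₀ + η₁) + 2 * Ierr.toReal + 2 * T * Kc) with hB
  have hB_val : 2 * N₀ * (η₀ + η₁) + 2 * Ierr.toReal + 2 * T * Kc = α₀ := by rw [hα₀, hIerr]
  have hφG_pos : ∀ {s : ℝ}, 0 < s → φG s = ENNReal.ofReal (e s) := fun hs => by simp [hφG, hs]
  have hstep3 : ∀ τ ∈ Ioc 0 T, ENNReal.ofReal (e τ) ≤ B + ∫⁻ s in Ioo 0 τ, aG s * φG s := by
    intro τ hτ
    have hτT : Ioo 0 τ ⊆ Ioo 0 T := Ioo_subset_Ioo le_rfl hτ.2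
    have h1 := hstep1 τ hτ
    -- `-∫ FG ≤ (∫⁻ ofReal(½ c e + err + Kc)).toReal`
    have hsl : ∀ᵐ s ∂(volume.restrict (Ioo 0 τ)), -FG s ≤ 2⁻¹ * (c s * e s) + err s + Kc ∧
        err s ≤ Ce * c s := ae_restrict_of_ae_restrict_of_subset hτT hslice
    have hpos : ∀ᵐ s ∂(volume.restrict (Ioo 0 τ)), ENNReal.ofReal (-FG s) ≤
        ENNReal.ofReal (2⁻¹ * (c s * e s)) + (ENNReal.ofReal (err s) + ENNReal.ofReal Kc) := by
      filter_upwards [hsl] with s hs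
      have hce : 0 ≤ 2⁻¹ * (c s * e s) := by
        have := he0 s; have := (ENNReal.toReal_nonneg : 0 ≤ c s); positivity
      have herr0 : 0 ≤ err s := by rw [herr]; positivity
      rw [← ENNReal.ofReal_add herr0 hKc0, ← ENNReal.ofReal_add hce (by positivity)]
      exact ENNReal.ofReal_le_ofReal (by linarith [hs.1])
    have hmeas1 : AEMeasurable (fun s => ENNReal.ofReal (2⁻¹ * (c s * e s))) (volume.restrict (Ioo 0 τ)) := by
      have hem' : AEStronglyMeasurable e (volume.restrict (Ioo 0 τ)) :=
        hem.mono_measure (Measure.restrict_mono hτT le_rfl)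
      exact ((hcm'.aemeasurable.mul hem'.aemeasurable).const_mul _).ennreal_ofReal
    have hI1 : ∫⁻ s in Ioo 0 τ, ENNReal.ofReal (2⁻¹ * (c s * e s)) ≠ ⊤ := by
      have hM : 0 ≤ 2⁻¹ * ((N₀ + R) ^ 2) := by positivity
      have hcfinτ : ∫⁻ s in Ioo 0 τ, ENNReal.ofReal (c s) ≠ ⊤ :=
        ne_top_of_le_ne_top hΛfin ((lintegral_mono_set hτT).trans haint)
      refine ne_top_of_le_ne_top (ENNReal.mul_ne_top (ENNReal.ofReal_ne_top
        (r := 2⁻¹ * (N₀ + R) ^ 2)) hcfinτ) ?_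
      calc ∫⁻ s in Ioo 0 τ, ENNReal.ofReal (2⁻¹ * (c s * e s))
          ≤ ∫⁻ s in Ioo 0 τ, ENNReal.ofReal (2⁻¹ * (N₀ + R) ^ 2) * ENNReal.ofReal (c s) := by
            refine lintegral_mono_ae ?_
            filter_upwards [ae_restrict_mem measurableSet_Ioo] with s hs
            rw [← ENNReal.ofReal_mul hM]
            refine ENNReal.ofReal_le_ofReal ?_
            have h := heM s ⟨hs.1.le, hs.2.le.trans hτ.2⟩
            have hc0 : 0 ≤ c s := ENNReal.toReal_nonneg
            nlinarith
        _ = ENNReal.ofReal (2⁻¹ * (N₀ + R) ^ 2) * ∫⁻ s in Ioo 0 τ, ENNReal.ofReal (c s) :=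
            lintegral_const_mul _ hcm'.ennreal_ofReal
    have hIerrτ : ∫⁻ s in Ioo 0 τ, ENNReal.ofReal (err s) ≤ Ierr := lintegral_mono_set hτT
    have hI2 : ∫⁻ s in Ioo 0 τ, (ENNReal.ofReal (err s) + ENNReal.ofReal Kc) ≠ ⊤ := by
      rw [lintegral_add_right' _ aemeasurable_const, lintegral_const]
      refine ENNReal.add_ne_top.2 ⟨ne_top_of_le_ne_top herr_fin.ne hIerrτ, ?_⟩
      exact ENNReal.mul_ne_top ENNReal.ofReal_ne_top (measure_ne_top _ _)
    have hneg : -(∫ s in Ioo 0 τ, FG s) ≤ (∫⁻ s in Ioo 0 τ, ENNReal.ofReal (2⁻¹ * (c s * e s))).toReal +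
        (Ierr.toReal + T * Kc) := by
      rw [← integral_neg]
      refine (hint_le (fun s => -FG s) ?_).trans ?_
      · refine ne_top_of_le_ne_top ?_ (lintegral_mono_ae hpos)
        rw [lintegral_add_left' hmeas1]
        exact ENNReal.add_ne_top.2 ⟨hI1, hI2⟩
      · have h := ENNReal.toReal_mono (by rw [lintegral_add_left' hmeas1]; exact ENNReal.add_ne_top.2 ⟨hI1, hI2⟩)
          (lintegral_mono_ae hpos)
        refine h.trans ?_
        rw [lintegral_add_left' hmeas1, ENNReal.toReal_add hI1 hI2, lintegral_add_right' _ aemeasurable_const,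
          lintegral_const, ENNReal.toReal_add (ne_top_of_le_ne_top herr_fin.ne hIerrτ)
            (ENNReal.mul_ne_top ENNReal.ofReal_ne_top (measure_ne_top _ _))]
        have hvol : (ENNReal.ofReal Kc * (volume.restrict (Ioo 0 τ)) univ).toReal ≤ T * Kc := by
          rw [Measure.restrict_apply_univ, Real.volume_Ioo, ENNReal.toReal_mul,
            ENNReal.toReal_ofReal hKc0, ENNReal.toReal_ofReal (by linarith [hτ.1]), mul_comm]
          have : τ - 0 ≤ T := by linarith [hτ.2]
          exact mul_le_mul_of_nonneg_right this hKc0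
        have herrτ : (∫⁻ s in Ioo 0 τ, ENNReal.ofReal (err s)).toReal ≤ Ierr.toReal :=
          ENNReal.toReal_mono herr_fin.ne hIerrτ
        linarith
    -- `2 ∫⁻ ofReal(½ c e) = ∫⁻ a φ` on `(0, τ)`
    have hkernel : 2 * (∫⁻ s in Ioo 0 τ, ENNReal.ofReal (2⁻¹ * (c s * e s))) =
        ∫⁻ s in Ioo 0 τ, aG s * φG s := by
      rw [← lintegral_const_mul'' _ hmeas1]
      refine setLIntegral_congr_fun measurableSet_Ioo fun s hs => ?_
      rw [hφG_pos hs.1, haG]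
      dsimp only
      rw [← ENNReal.ofReal_mul ENNReal.toReal_nonneg, ← ENNReal.ofReal_ofNat 2,
        ← ENNReal.ofReal_mul zero_le_two]
      congr 1; ring
    -- assemble in `ℝ≥0∞`
    have hreal : e τ ≤ (2 * N₀ * (η₀ + η₁) + 2 * Ierr.toReal + 2 * T * Kc) +
        (2 * (∫⁻ s in Ioo 0 τ, ENNReal.ofReal (2⁻¹ * (c s * e s)))).toReal := by
      rw [ENNReal.toReal_mul, ENNReal.toReal_ofNat]
      linarith [h1, hneg]
    calc ENNReal.ofReal (e τ)
        ≤ ENNReal.ofReal ((2 * N₀ * (η₀ + η₁) + 2 * Ierr.toReal + 2 * T * Kc) +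
            (2 * (∫⁻ s in Ioo 0 τ, ENNReal.ofReal (2⁻¹ * (c s * e s)))).toReal) :=
          ENNReal.ofReal_le_ofReal hreal
      _ ≤ B + ENNReal.ofReal ((2 * (∫⁻ s in Ioo 0 τ, ENNReal.ofReal (2⁻¹ * (c s * e s)))).toReal) :=
          ENNReal.ofReal_add_le
      _ ≤ B + ∫⁻ s in Ioo 0 τ, aG s * φG s := by
          rw [← hkernel]; exact add_le_add le_rfl ENNReal.ofReal_toReal_le
  -- ### Step 4: Grönwall
  have hφM : ∀ τ ∈ Icc 0 T, φG τ ≤ ENNReal.ofReal ((N₀ + R) ^ 2) := by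
    intro τ hτ
    by_cases h0 : 0 < τ
    · rw [hφG_pos h0]; exact ENNReal.ofReal_le_ofReal (heM τ hτ)
    · simp [hφG, h0]
  have haT : ∫⁻ s in Ioo 0 T, aG s ≠ ⊤ := ne_top_of_le_ne_top hΛfin haint
  have hφ_hyp : ∀ τ ∈ Icc 0 T, φG τ ≤ B + ∫⁻ s in Ioo 0 τ, aG s * φG s := by
    intro τ hτ
    by_cases h0 : 0 < τ
    · rw [hφG_pos h0]; exact hstep3 τ ⟨h0, hτ.2⟩
    · simp [hφG, h0]
  have hG := lintegral_gronwall_le (S := T) ENNReal.ofReal_ne_top ENNReal.ofReal_ne_top hφM haT hφ_hyp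
    t ⟨ht.1.le, ht.2⟩
  rw [hφG_pos ht.1] at hG
  -- compare exponents and conclude in `ℝ`
  have hexp_le : Real.exp (∫⁻ s in Ioo 0 t, aG s).toReal ≤ Real.exp Λ := by
    refine Real.exp_le_exp.2 (ENNReal.toReal_mono hΛfin ?_)
    exact (lintegral_mono_set htT).trans haint
  have hα₀0 : 0 ≤ α₀ := by
    rw [← hB_val]
    have : 0 ≤ Ierr.toReal := ENNReal.toReal_nonneg
    have hη₀0 : 0 ≤ η₀ := ENNReal.toReal_nonneg
    positivity
  have hfinal : ENNReal.ofReal (e t) ≤ ENNReal.ofReal (α₀ * Real.exp Λ) := by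
    refine hG.trans ?_
    rw [hB_val, ← ENNReal.ofReal_mul hα₀0]
    exact ENNReal.ofReal_le_ofReal (mul_le_mul_of_nonneg_left hexp_le hα₀0)
  exact (ENNReal.ofReal_le_ofReal_iff (by positivity)).1 hfinal

end Gronwall

end Literature.Analysis.FluidPDE
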